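/-
Copyright (c) 2026 the pub-hodgecm-mathlib formalisation cell (harness21).  Prover seat hodgecm-mathlib-K2E1-p08 (g2), Track B ∕ K2-LIT, h413 =
`stmt-HodgeConjecture-24833`, line `K2_E1_TraceFormulaBeta`; BY-NAME DEAL #11 (typed) of the dealer K2E1-plan (g2) 2026-09-04T00:07:54Z, companion of the defs leaf
`Theorems/K2E1ResidualBlocksDefs.lean`.
-/
import Summits.HodgeConjecture.HodgeConjecture.Theorems.K2E1ResidualBlocksDefs              -- ★ (this seat): `resBlock`, (R-a) `ResidualBlocksCompact`, (R-b) `ResidualBlocksDecay`, `Cm…R` readings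
import Summits.HodgeConjecture.HodgeConjecture.Theorems.K2E1BlockDiagonalCompact            -- ★ p855862 (this seat): `residualSpectrumCompact_of_blocks`, `cmResidualSpectrumCompactR_of_blocks`
import Literature.NumberTheory.Automorphic.FiniteMultiplicityCriterion                      -- ★ `ClosedSubrep.isOrtho_inflate_iff`, `ClosedSubrep.areUnitarilyEquivalent_inflate`
import Literature.NumberTheory.Automorphic.HilbertRepDiscretePart                           -- ★ `isDiscretelyDecomposable_discretePart`
import Literature.NumberTheory.Automorphic.AutomorphicRepsGLCuspidalSpectralExpansion       -- ★ `ClosedSubrep.isDiscretelyDecomposable_toContRep_of_le` (heredity)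
import HarnessLib

/-!
# K2·E1 — RESIDUAL COMPACTNESS FROM THE RESIDUAL BLOCKS: `hWo` and `hres` of ★ p855862 PROVED for the isotypic blocks `resBlock`, and the sockets
# `sig_K2E1ResidualCompactU2` ∕ `sig_K2E1ResidualCompactU3R` (★ `CmResidualSpectrumCompactR L N μ`) ⟸ the NAMED inputs (R-a) `ResidualBlocksCompact` + (R-b) `ResidualBlocksDecay` ONLY

Track B ∕ K2-LIT, crux h413 = `stmt-HodgeConjecture-24833`, route of record `HCCMUnconditional`; cell `hodgecm-mathlib`, squad K2, ENGINE E1; prover seat `hodgecm-mathlib-K2E1-p08` (g2),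
BY-NAME DEAL #11 (typed) of the dealer K2E1-plan (g2) 2026-09-04T00:07:54Z («TYPE (R-a)∕(R-b) at `N = 3` as named Props + the kernel-certified composition through ★ p855862 — socket ⟸
named Props ONLY», the pattern of ★ p855718 ∕ ★ p855969); lane `--kind proof --supports stmt-HodgeConjecture-24833 --as helper` (count-neutral).  THEOREMS ONLY (no `def`, no instance,
no notation, no `sorry`).  HONEST LABEL: HC_CM is proved only modulo the 7 printed citations (2 remaining named inputs: hLiu418 = `stmt-HodgeConjecture-24832`, h413 =
`stmt-HodgeConjecture-24833`) until rung 0 closes; this file closes no socket by itself: it REDUCES the residual-compactness sockets to the two named inputs of the defs leaf.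

THE ROAD.  ★ p855862 `residualSpectrumCompact_of_blocks` (block-diagonal compact operators) wants: an orthogonal family of closed `R`-invariant blocks `W j` (`hWo`), `L²_res ≤ closure (⨆ W j)`
(`hres`), and per Haar `η` and `f`: compactness of `R(f)` on each block + decay of `‖R(f)|W j‖` (`hRb`).  With `W := resBlock 𝒢 μ 𝔓` — the isotypic components of `L²_res` indexed by the
discrete classes (★ defs leaf; print at `N = 3`: the lines `ℂ·(χ∘det)` and the `⊗_v π^n(ξ_v)` [Rogawski1990, Thm. 13.3.6 (b) p. 200, §13.9 p. 227]) — the first two are THEOREMS: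
* §1 `isOrtho_resBlock`, **`orthogonalFamily_resBlock`** (`hWo`): Schur orthogonality of inequivalent isotypic components (★ `isOrtho_isotypicComponent`) through ★ `isOrtho_inflate_iff`;
* §2 `isDiscretelyDecomposable_residualSubspace` (heredity from `L²_disc`), `inflate_le_resBlock_mk` (each irreducible of `L²_res` lies in its block), `residualSubspace_le_iSupClosure_resBlock`,
  **`residualSubspace_le_closure_iSup_resBlock`** (`hres`);
and the third is exactly the pair of NAMED inputs (R-a) ★ `ResidualBlocksCompact` ∕ (R-b) ★ `ResidualBlocksDecay` (generic) or their test-function readings ★ `CmResidualBlocksCompactR` ∕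
★ `CmResidualBlocksDecayR` (`U(Φ_N)`):
* §3 **`residualSpectrumCompact_of_Ra_Rb : ResidualBlocksCompact 𝒢 μ 𝔓 → ResidualBlocksDecay 𝒢 μ 𝔓 → ResidualSpectrumCompact 𝒢 μ 𝔓`** (generic ★ adelic datum);
* §4 **`cmResidualSpectrumCompactR_of_Ra_Rb : CmResidualBlocksCompactR L N μ → CmResidualBlocksDecayR L N μ → CmResidualSpectrumCompactR L N μ`** (all `N`; ★ p855862's test-function
  version, density ★ p855818) and `cmResidualSpectrumCompactR_of_Ra_Rb'` (from the generic inputs at the instance).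
WHAT REMAINS NAMED (and why it is print's content, not plumbing): (R-a) = finite multiplicity [BorelJacquetCorvallis1979 §4.6; Rogawski1990 Thm. 13.3.1 `m = 1`] + admissibility of the
irreducible unitary members (Harish-Chandra; Bernstein; Flath) or trace class [Muller1989TraceClass Thm. 0.1]; (R-b) = Harish-Chandra finiteness per `K`-type of the residual classes
[HarishChandra1968 Thm. 1] read off Rogawski's description of `L²_res(U(3))` [Thm. 13.3.6 (b)] + `L¹`-density of `K`-finite test functions.

## References
* [Rogawski1990] J. Rogawski, *Automorphic Representations of Unitary Groups in Three Variables* (1990), Thm. 13.3.1 p. 199, Thm. 13.3.6 (b) p. 200, §13.9 p. 227.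
* [MoeglinWaldspurger1995] C. Mœglin, J.-L. Waldspurger, *Spectral Decomposition and Eisenstein Series* (1995), I.2.18, V.3.13.
* [DeitmarEchterhoff2014] A. Deitmar, S. Echterhoff, *Principles of Harmonic Analysis*, 2nd ed. (2014), Cor. 6.1.9, §7.3 Thm. 7.3.2.
* [Dixmier1977] J. Dixmier, *C\*-algebras* (1977), §5.4, §13.1.2.
* [Muller1989TraceClass] W. Müller, *The trace class conjecture in the theory of automorphic forms*, Ann. of Math. 130 (1989), Thm. 0.1.
* [ReedSimonI1980] M. Reed, B. Simon, *Functional Analysis* I (1980), Thm. VI.12.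
-/

set_option autoImplicit false
set_option linter.dupNamespace false  -- the mandated namespace repeats the summit's segment (`HodgeConjecture.HodgeConjecture`)

noncomputable section

open Filter Topology MeasureTheory CompactlySupported
open Literature.NumberTheory.Automorphic ContRepresentation
open Summit.HodgeConjecture.HodgeConjecture.Cruxes.H413.K2E1CuspidalSpectrumUnitary
open Summit.HodgeConjecture.HodgeConjecture.Cruxes.H413.K2E1SpectralTermsDiscreteHalf

namespace Summit.HodgeConjecture.HodgeConjecture.Cruxes.H413.K2E1ResidualCompactOfBlocks

open Summit.HodgeConjecture.HodgeConjecture.Cruxes.H413.K2E1ResidualBlocks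
open Summit.HodgeConjecture.HodgeConjecture.Cruxes.H413.K2E1BlockDiagonalCompact (residualSpectrumCompact_of_blocks cmResidualSpectrumCompactR_of_blocks)

universe u

/-! ## §1 `hWo`: distinct blocks are orthogonal -/

section Generic

variable {K : Type} [Field K] [NumberField K] (𝒢 : AdelicGroupData.{u} K) (μ : Measure 𝒢.automorphicQuotient) [𝒢.IsAutomorphicMeasure μ]
  (𝔓 : 𝒢.ParabolicUnipotentData)

/-- **DISTINCT RESIDUAL BLOCKS ARE ORTHOGONAL.**  For discrete classes `c ≠ c′` the blocks `L²_res[c] ⟂ L²_res[c′]`: the chosen representatives are inequivalent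
(`DiscreteClass.mk_out`, `mk_eq_mk_iff`), so the isotypic components of the (unitary) residual spectrum are orthogonal (★ `isOrtho_isotypicComponent`, Schur ∕
Deitmar–Echterhoff Cor. 6.1.9, Thm. 7.3.2 (c)), and inflation to `L²` preserves orthogonality (★ `ClosedSubrep.isOrtho_inflate_iff`). [cite: DeitmarEchterhoff2014, Cor. 6.1.9 and Thm. 7.3.2]
[cite: Dixmier1977, §5.4] -/
theorem isOrtho_resBlock {c c' : DiscreteClass 𝒢 μ} (hne : c ≠ c') :
    (resBlock 𝒢 μ 𝔓 c).toSubmodule ⟂ (resBlock 𝒢 μ 𝔓 c').toSubmodule := by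
  rw [resBlock_def, resBlock_def, ClosedSubrep.isOrtho_inflate_iff]
  refine isOrtho_isotypicComponent (ClosedSubrep.isUnitary_toContRep (𝒢.isUnitary_rightRegular μ) _) fun he => hne ?_
  rw [← DiscreteClass.mk_out c, ← DiscreteClass.mk_out c']
  exact (DiscreteClass.mk_eq_mk_iff _ _).2 he

/-- **`hWo` OF ★ p855862, PROVED: the residual blocks form an ORTHOGONAL FAMILY** indexed by the discrete classes (Mathlib `OrthogonalFamily.of_pairwise`).
[cite: DeitmarEchterhoff2014, Thm. 7.3.2] [cite: Dixmier1977, §5.4] -/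
theorem orthogonalFamily_resBlock :
    OrthogonalFamily ℂ (fun c : DiscreteClass 𝒢 μ => ↥(resBlock 𝒢 μ 𝔓 c).toSubmodule) fun c => (resBlock 𝒢 μ 𝔓 c).toSubmodule.subtypeₗᵢ :=
  OrthogonalFamily.of_pairwise fun _ _ hne => isOrtho_resBlock 𝒢 μ 𝔓 hne

/-! ## §2 `hres`: `L²_res` is the closed span of its blocks -/

/-- **`L²_res` IS DISCRETELY DECOMPOSABLE** (the closed span of its irreducible closed subrepresentations): `L²_res ≤ L²_disc` (★ `residualSubspace_le_discreteSpectrum`),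
`L²_disc` is discretely decomposable as a representation in its own right (★ `isDiscretelyDecomposable_discretePart`), and discrete decomposability is inherited by closed
subrepresentations of a unitary representation (★ `ClosedSubrep.isDiscretelyDecomposable_toContRep_of_le`). [cite: Dixmier1977, §5.4] [cite: MoeglinWaldspurger1995, I.2.18] -/
theorem isDiscretelyDecomposable_residualSubspace : (residualSubspace 𝒢 μ 𝔓).toContRep.IsDiscretelyDecomposable :=
  ClosedSubrep.isDiscretelyDecomposable_toContRep_of_le (𝒢.isUnitary_rightRegular μ) isDiscretelyDecomposable_discretePart
    (residualSubspace_le_discreteSpectrum 𝒢 μ 𝔓)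

/-- **EVERY IRREDUCIBLE OF `L²_res` LIES IN ITS OWN BLOCK**: for a topologically irreducible closed subrepresentation `W₀` of `L²_res`, its inflation `W ≤ L²` is a discrete
automorphic representation and `W ≤ L²_res[mk W]` (★ `le_isotypicComponent`; the equivalences ★ `areUnitarilyEquivalent_inflate`, `DiscreteClass.areUnitarilyEquivalent_out`).
[cite: DeitmarEchterhoff2014, §7.3] [cite: Dixmier1977, §13.1.2] -/
theorem inflate_le_resBlock_mk {W₀ : ClosedSubrep (residualSubspace 𝒢 μ 𝔓).toContRep} (hW₀ : W₀.toContRep.IsTopIrreducible) :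
    (residualSubspace 𝒢 μ 𝔓).inflate W₀ ≤
      resBlock 𝒢 μ 𝔓 (DiscreteClass.mk ⟨(residualSubspace 𝒢 μ 𝔓).inflate W₀, (ClosedSubrep.isTopIrreducible_inflate_iff _ W₀).2 hW₀⟩) := by
  set P : DiscreteAutomorphicRep 𝒢 μ := ⟨(residualSubspace 𝒢 μ 𝔓).inflate W₀, (ClosedSubrep.isTopIrreducible_inflate_iff _ W₀).2 hW₀⟩
  have hPs : P.space = (residualSubspace 𝒢 μ 𝔓).inflate W₀ := rfl
  have he : AreUnitarilyEquivalent W₀.toContRep (DiscreteClass.mk P).out.space.toContRep := by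
    refine AreUnitarilyEquivalent.trans ?_ (DiscreteClass.areUnitarilyEquivalent_out (P := P) rfl)
    rw [hPs]
    exact (ClosedSubrep.areUnitarilyEquivalent_inflate _ W₀).symm
  rw [resBlock_def, ClosedSubrep.inflate_le_inflate_iff]
  exact le_isotypicComponent hW₀ he

/-- **`L²_res` IS THE CLOSED SPAN OF ITS BLOCKS** (as closed subrepresentations): `L²_res ≤ closure (⨆_c L²_res[c])`.  Proof: inside `L²_res` the discrete part is everything
(`isDiscretelyDecomposable_residualSubspace`) and is generated by irreducibles each lying in a block (`inflate_le_resBlock_mk`), read back in `L²` through ★ `ClosedSubrep.inflate` ∕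
`restrictLE` (`inflate_top`, `inflate_le_inflate_iff`, `inflate_restrictLE`). [cite: Dixmier1977, §5.4] [cite: MoeglinWaldspurger1995, I.2.18 and V.3.13] -/
theorem residualSubspace_le_iSupClosure_resBlock :
    residualSubspace 𝒢 μ 𝔓 ≤ ClosedSubrep.iSupClosure (Set.range (resBlock 𝒢 μ 𝔓)) := by
  set C := residualSubspace 𝒢 μ 𝔓 with hC
  set T := ClosedSubrep.iSupClosure (Set.range (resBlock 𝒢 μ 𝔓)) with hT
  -- every irreducible of `L²_res` lies (inflated) in its own block, hence in `T`
  have hirr : C.toContRep.discretePart ≤ C.restrictLE T := by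
    refine ClosedSubrep.iSupClosure_le fun W₀ hW₀ => ?_
    intro w hw
    rw [ClosedSubrep.mem_restrictLE_iff]
    have h1 : (w : 𝒢.L2 μ) ∈ C.inflate W₀ := ClosedSubrep.coe_mem_inflate C W₀ hw
    exact ClosedSubrep.le_iSupClosure (Set.mem_range_self _) (inflate_le_resBlock_mk 𝒢 μ 𝔓 hW₀ h1)
  -- `L²_res` is discretely decomposable, and `T ≤ L²_res`
  have hdd : C.toContRep.discretePart = ⊤ := isDiscretelyDecomposable_residualSubspace 𝒢 μ 𝔓
  have hTC : T ≤ C := ClosedSubrep.iSupClosure_le (by rintro _ ⟨c, rfl⟩; exact resBlock_le_residualSubspace 𝒢 μ 𝔓 c)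
  have htop : (⊤ : ClosedSubrep C.toContRep) ≤ C.restrictLE T := by rw [← hdd]; exact hirr
  calc C = C.inflate ⊤ := (ClosedSubrep.inflate_top C).symm
    _ ≤ C.inflate (C.restrictLE T) := (ClosedSubrep.inflate_le_inflate_iff C).2 htop
    _ = T := ClosedSubrep.inflate_restrictLE C hTC

/-- **`hres` OF ★ p855862, PROVED, in its submodule currency**: `(L²_res : Submodule) ≤ (⨆ c, L²_res[c]).topologicalClosure` (`iSup_range` on the previous theorem).
[cite: Dixmier1977, §5.4] [cite: MoeglinWaldspurger1995, I.2.18 and V.3.13] -/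
theorem residualSubspace_le_closure_iSup_resBlock :
    (residualSubspace 𝒢 μ 𝔓).toSubmodule ≤ (⨆ c, (resBlock 𝒢 μ 𝔓 c).toSubmodule).topologicalClosure := by
  intro v hv
  have h := residualSubspace_le_iSupClosure_resBlock 𝒢 μ 𝔓 hv
  change v ∈ (⨆ W ∈ Set.range (resBlock 𝒢 μ 𝔓), (W : ClosedSubrep (𝒢.rightRegular μ)).toSubmodule).topologicalClosure at h
  rwa [iSup_range] at h

/-! ## §3 The generic composition: `ResidualSpectrumCompact` ⟸ (R-a) + (R-b) -/

/-- **★ `ResidualSpectrumCompact 𝒢 μ 𝔓` ⟸ (R-a) + (R-b), BY NAME** — generic ★ adelic datum: with the blocks `resBlock 𝒢 μ 𝔓` (orthogonal: `orthogonalFamily_resBlock`; spanning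
`L²_res`: `residualSubspace_le_closure_iSup_resBlock`), compactness of `R(f)` on each block (★ `ResidualBlocksCompact`) and decay of the block norms (★ `ResidualBlocksDecay`) give
compactness of `R(f)` on `L²_res` by ★ p855862 `residualSpectrumCompact_of_blocks` (block-diagonal compact operators). [cite: MoeglinWaldspurger1995, I.2.18 and V.3.13]
[cite: Muller1989TraceClass, Thm. 0.1] [cite: ReedSimonI1980, Thm. VI.12] -/
theorem residualSpectrumCompact_of_Ra_Rb (hRa : ResidualBlocksCompact 𝒢 μ 𝔓) (hRb : ResidualBlocksDecay 𝒢 μ 𝔓) : ResidualSpectrumCompact 𝒢 μ 𝔓 :=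
  residualSpectrumCompact_of_blocks 𝒢 μ 𝔓 (resBlock 𝒢 μ 𝔓) (orthogonalFamily_resBlock 𝒢 μ 𝔓) (residualSubspace_le_closure_iSup_resBlock 𝒢 μ 𝔓)
    fun η _ f => ⟨fun c => hRa η f c, hRb η f⟩

end Generic

/-! ## §4 The `U(Φ_N)` composition: sockets `sig_K2E1ResidualCompactU2` ∕ `…U3R` ⟸ (R-a) + (R-b) on test functions -/

section Unitary

open NumberField Literature.NumberTheory.Automorphic.UnitaryGroup

variable (L : Type) [Field L] [NumberField L] [IsCMField L] (N : ℕ)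
  (μ : Measure (cmDatum L N (Matrix.of fun i j : Fin N => if i.val + j.val + 1 = N then (1 : L) else 0)).automorphicQuotient)
  [(cmDatum L N (Matrix.of fun i j : Fin N => if i.val + j.val + 1 = N then (1 : L) else 0)).IsAutomorphicMeasure μ]

/-- **SOCKETS `sig_K2E1ResidualCompactU2` ∕ `sig_K2E1ResidualCompactU3R` ⟸ (R-a) + (R-b) ON TEST FUNCTIONS, BY NAME** (all `N`): ★ `CmResidualSpectrumCompactR L N μ` from
★ `CmResidualBlocksCompactR L N μ` and ★ `CmResidualBlocksDecayR L N μ` — the blocks of `L²_res(U(Φ_N))` along the printed radicals ★ `cmParabolicDataR L N` (at `N = 3`: the lines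
`ℂ·(χ∘det)` and the `⊗_v π^n(ξ_v)`, [Rogawski1990, Thm. 13.3.6 (b)]), through ★ p855862 `cmResidualSpectrumCompactR_of_blocks` (test functions, then all of `C_c` by density ★ p855818).
[cite: Rogawski1990, Thm. 13.3.6 (b) p. 200 and §13.9 p. 227] [cite: MoeglinWaldspurger1995, I.2.18 and V.3.13] [cite: Muller1989TraceClass, Thm. 0.1] -/
theorem cmResidualSpectrumCompactR_of_Ra_Rb (hRa : CmResidualBlocksCompactR L N μ) (hRb : CmResidualBlocksDecayR L N μ) : CmResidualSpectrumCompactR L N μ :=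
  cmResidualSpectrumCompactR_of_blocks L N μ (resBlock _ μ (cmParabolicDataR L N)) (orthogonalFamily_resBlock _ μ _) (residualSubspace_le_closure_iSup_resBlock _ μ _)
    fun η _ φ hφ => ⟨hRa η φ hφ, hRb η φ hφ⟩

/-- **The same sockets from the GENERIC (R-a) + (R-b) at the `U(Φ_N)` instance** (all `f ∈ C_c`; `CmResidualSpectrumCompactR` unfolds to ★ `ResidualSpectrumCompact` at
`(cmDatum L N Φ_N, μ, cmParabolicDataR L N)`). [cite: Rogawski1990, Thm. 13.3.6 (b) p. 200] [cite: MoeglinWaldspurger1995, I.2.18 and V.3.13] -/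
theorem cmResidualSpectrumCompactR_of_Ra_Rb' (hRa : ResidualBlocksCompact (cmDatum L N (Matrix.of fun i j : Fin N => if i.val + j.val + 1 = N then (1 : L) else 0)) μ (cmParabolicDataR L N))
    (hRb : ResidualBlocksDecay (cmDatum L N (Matrix.of fun i j : Fin N => if i.val + j.val + 1 = N then (1 : L) else 0)) μ (cmParabolicDataR L N)) :
    CmResidualSpectrumCompactR L N μ :=
  residualSpectrumCompact_of_Ra_Rb _ μ _ hRa hRb

end Unitary

end Summit.HodgeConjecture.HodgeConjecture.Cruxes.H413.K2E1ResidualCompactOfBlocks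

end
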